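import Mathlib

/-!
# Matchings with pool-or-free-supply witnesses imply the two-type inequality (X2)

Support file (`--supports stmt-CriticalPhenomena-4575`, closed), prover `prim-cplus-coupling` (gen 70); the chordless
('refined') form of `JoinMatching.x2_of_matchings`.  Memos `prim-cplus-coupling/A5-COUPLING-gen69.md` §1.2 and
`A5-COUPLING-gen70.md` §1.

On a finite preordered type `X` let `D1, B2` be the exclusive source sets of the two types, `T1, T2 ⊆ NE` their typed
target sets, `NE` the supply region and `P` the pool.  An **X2-match** consists of increasing injections
`φ₁ : D1 → T1`, `φ₂ : B2 → T2` together with an injective witness map `ψ` on the collisions `t = φ₁ y₁ = φ₂ y₂`, lying above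
both colliding sources, whose values are EITHER pool points (`ψ t ∈ P`) OR *free supply points*: points of `NE` that are not
the image of any exclusive source.  An X2-match gives, for all upper sets `A, C` simultaneously,

  `#((A \ C) ∩ D1) + #((C \ A) ∩ B2) ≤ #((A \ C) ∩ T1) + #((C \ A) ∩ T2) + #(A ∩ C ∩ NE) + #(A ∩ C ∩ P)`   (X2).

Compared with `x2_of_matchings` (witnesses in `P` only) the third term of (X2) is used to its full extent: it credits every
supply point of `A ∩ C`, not only typed targets, so an unused supply point above the join pays for a collision.  This is the
matching certificate behind the chordless case of the bundle inequality (no unit thread), where the pool `P` avoids the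
neutral colourings and is too small to witness every collision.  (With pool-only witnesses the hypotheses are those of
`JoinMatching.x2_of_matchings`, which is therefore a special case.)
[cite: KozmaNitzan2024, Questions 8–9 (§5.5 p. 36) (context); Harris 1960; Kleitman 1966]
-/

namespace Summit.CriticalPhenomena.PercolationContinuityZ3.Theorems.Coefficientwise.SupplyMatching

open Finset

variable {X : Type*} [DecidableEq X] [Preorder X]

/-- **X2-match ⟹ (X2).**  Increasing injections `φ₁ : D1 → T1`, `φ₂ : B2 → T2` into typed targets `T1, T2 ⊆ NE`, and an
injective witness map `ψ` on the collision targets with `ψ t` above both colliding sources and `ψ t ∈ P` or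
`ψ t ∈ NE \ (φ₁ D1 ∪ φ₂ B2)` (a free supply point), give the two-type inequality (X2) for every pair of upper sets `A, C`.
[Proof: the images of the bad sources of type 1 lie in `A ∩ T1`; those outside `C` are exclusive credits, the others lie in
`A ∩ C ∩ NE` (likewise for type 2), and the two image families overlap exactly at collisions inside `A ∩ C`, whose witnesses lie
in `A ∩ C` (upper sets) and either in `P` or in the part of `A ∩ C ∩ NE` used by no image.] -/
theorem x2_of_supply_matchings (D1 B2 T1 T2 NE P : Finset X) (hT1 : T1 ⊆ NE) (hT2 : T2 ⊆ NE)
    (φ₁ φ₂ ψ : X → X)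
    (h₁ : ∀ y ∈ D1, y ≤ φ₁ y ∧ φ₁ y ∈ T1) (h₁inj : Set.InjOn φ₁ (D1 : Set X))
    (h₂ : ∀ y ∈ B2, y ≤ φ₂ y ∧ φ₂ y ∈ T2) (h₂inj : Set.InjOn φ₂ (B2 : Set X))
    (hψ : ∀ y₁ ∈ D1, ∀ y₂ ∈ B2, φ₁ y₁ = φ₂ y₂ →
      y₁ ≤ ψ (φ₁ y₁) ∧ y₂ ≤ ψ (φ₁ y₁) ∧
        (ψ (φ₁ y₁) ∈ P ∨ (ψ (φ₁ y₁) ∈ NE ∧ ψ (φ₁ y₁) ∉ D1.image φ₁ ∧ ψ (φ₁ y₁) ∉ B2.image φ₂)))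
    (hψinj : Set.InjOn ψ ((D1.image φ₁ ∩ B2.image φ₂ : Finset X) : Set X))
    (A C : Finset X) (hA : IsUpperSet (A : Set X)) (hC : IsUpperSet (C : Set X)) :
    ((A \ C) ∩ D1).card + ((C \ A) ∩ B2).card ≤
      ((A \ C) ∩ T1).card + ((C \ A) ∩ T2).card + (A ∩ C ∩ NE).card + (A ∩ C ∩ P).card := by
  classical
  -- bad sources and their images
  set S₁ : Finset X := (A \ C) ∩ D1 with hS₁
  set S₂ : Finset X := (C \ A) ∩ B2 with hS₂
  set I₁ : Finset X := S₁.image φ₁ with hI₁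
  set I₂ : Finset X := S₂.image φ₂ with hI₂
  have hS₁D : S₁ ⊆ D1 := inter_subset_right
  have hS₂B : S₂ ⊆ B2 := inter_subset_right
  have hc₁ : I₁.card = S₁.card :=
    card_image_of_injOn (h₁inj.mono (by intro y hy; exact mem_coe.mpr (hS₁D (mem_coe.mp hy))))
  have hc₂ : I₂.card = S₂.card :=
    card_image_of_injOn (h₂inj.mono (by intro y hy; exact mem_coe.mpr (hS₂B (mem_coe.mp hy))))
  -- where the images live
  have hI₁A : ∀ t ∈ I₁, t ∈ A ∧ t ∈ T1 := by
    intro t ht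
    obtain ⟨y, hy, rfl⟩ := mem_image.mp ht
    obtain ⟨hyAC, hyD⟩ := mem_inter.mp hy
    obtain ⟨hle, hT⟩ := h₁ y hyD
    exact ⟨mem_coe.mp (hA hle (mem_coe.mpr (mem_sdiff.mp hyAC).1)), hT⟩
  have hI₂C : ∀ t ∈ I₂, t ∈ C ∧ t ∈ T2 := by
    intro t ht
    obtain ⟨y, hy, rfl⟩ := mem_image.mp ht
    obtain ⟨hyCA, hyB⟩ := mem_inter.mp hy
    obtain ⟨hle, hT⟩ := h₂ y hyB
    exact ⟨mem_coe.mp (hC hle (mem_coe.mpr (mem_sdiff.mp hyCA).1)), hT⟩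
  -- split each image set along the other upper set
  have hsplit₁ : I₁.card = (I₁ \ C).card + (I₁ ∩ C).card := by
    rw [Nat.add_comm]; exact (card_inter_add_card_sdiff I₁ C).symm
  have hsplit₂ : I₂.card = (I₂ \ A).card + (I₂ ∩ A).card := by
    rw [Nat.add_comm]; exact (card_inter_add_card_sdiff I₂ A).symm
  have hex₁ : (I₁ \ C).card ≤ ((A \ C) ∩ T1).card := by
    refine card_le_card ?_
    intro t ht
    obtain ⟨htI, htC⟩ := mem_sdiff.mp ht
    obtain ⟨htA, htT⟩ := hI₁A t htI
    exact mem_inter.mpr ⟨mem_sdiff.mpr ⟨htA, htC⟩, htT⟩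
  have hex₂ : (I₂ \ A).card ≤ ((C \ A) ∩ T2).card := by
    refine card_le_card ?_
    intro t ht
    obtain ⟨htI, htA⟩ := mem_sdiff.mp ht
    obtain ⟨htC, htT⟩ := hI₂C t htI
    exact mem_inter.mpr ⟨mem_sdiff.mpr ⟨htC, htA⟩, htT⟩
  -- the shared parts J₁ = I₁ ∩ C and J₂ = I₂ ∩ A both lie in M := (A ∩ C ∩ NE) ∩ (I₁ ∪ I₂)
  set J₁ : Finset X := I₁ ∩ C with hJ₁
  set J₂ : Finset X := I₂ ∩ A with hJ₂
  set M : Finset X := (A ∩ C ∩ NE) ∩ (I₁ ∪ I₂) with hM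
  have hJU : J₁ ∪ J₂ ⊆ M := by
    intro t ht
    rcases mem_union.mp ht with ht | ht
    · obtain ⟨htI, htC⟩ := mem_inter.mp ht
      obtain ⟨htA, htT⟩ := hI₁A t htI
      exact mem_inter.mpr ⟨mem_inter.mpr ⟨mem_inter.mpr ⟨htA, htC⟩, hT1 htT⟩, mem_union_left _ htI⟩
    · obtain ⟨htI, htA⟩ := mem_inter.mp ht
      obtain ⟨htC, htT⟩ := hI₂C t htI
      exact mem_inter.mpr ⟨mem_inter.mpr ⟨mem_inter.mpr ⟨htA, htC⟩, hT2 htT⟩, mem_union_right _ htI⟩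
  -- the collisions inside A ∩ C: K = J₁ ∩ J₂ ⊆ φ₁ D1 ∩ φ₂ B2
  set K : Finset X := J₁ ∩ J₂ with hK
  have hKsub : K ⊆ D1.image φ₁ ∩ B2.image φ₂ := by
    intro t ht
    obtain ⟨ht₁, ht₂⟩ := mem_inter.mp ht
    refine mem_inter.mpr ⟨?_, ?_⟩
    · exact image_subset_image hS₁D (mem_inter.mp ht₁).1
    · exact image_subset_image hS₂B (mem_inter.mp ht₂).1
  -- witnesses of K lie in A ∩ C, and in P or in N := (A ∩ C ∩ NE) \ (I₁ ∪ I₂)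
  set N : Finset X := (A ∩ C ∩ NE) \ (I₁ ∪ I₂) with hN
  have hψK : K.image ψ ⊆ (A ∩ C ∩ P) ∪ N := by
    intro p hp
    obtain ⟨t, ht, rfl⟩ := mem_image.mp hp
    obtain ⟨ht₁, ht₂⟩ := mem_inter.mp ht
    obtain ⟨htI₁, _⟩ := mem_inter.mp ht₁
    obtain ⟨htI₂, _⟩ := mem_inter.mp ht₂
    obtain ⟨y₁, hy₁, h₁t⟩ := mem_image.mp htI₁
    obtain ⟨y₂, hy₂, h₂t⟩ := mem_image.mp htI₂
    obtain ⟨hy₁AC, hy₁D⟩ := mem_inter.mp hy₁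
    obtain ⟨hy₂CA, hy₂B⟩ := mem_inter.mp hy₂
    have heq : φ₁ y₁ = φ₂ y₂ := by rw [h₁t, h₂t]
    obtain ⟨hle₁, hle₂, halt⟩ := hψ y₁ hy₁D y₂ hy₂B heq
    rw [h₁t] at hle₁ hle₂ halt
    have hpA : ψ t ∈ A := mem_coe.mp (hA hle₁ (mem_coe.mpr (mem_sdiff.mp hy₁AC).1))
    have hpC : ψ t ∈ C := mem_coe.mp (hC hle₂ (mem_coe.mpr (mem_sdiff.mp hy₂CA).1))
    rcases halt with hP | ⟨hNE, hn₁, hn₂⟩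
    · exact mem_union_left _ (mem_inter.mpr ⟨mem_inter.mpr ⟨hpA, hpC⟩, hP⟩)
    · refine mem_union_right _ (mem_sdiff.mpr ⟨mem_inter.mpr ⟨mem_inter.mpr ⟨hpA, hpC⟩, hNE⟩, ?_⟩)
      intro hU
      rcases mem_union.mp hU with hU | hU
      · exact hn₁ (image_subset_image hS₁D hU)
      · exact hn₂ (image_subset_image hS₂B hU)
  have hKc : K.card ≤ (A ∩ C ∩ P).card + N.card := by
    calc K.card = (K.image ψ).card :=
          (card_image_of_injOn (hψinj.mono (by
            intro t ht; exact mem_coe.mpr (hKsub (mem_coe.mp ht))))).symm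
      _ ≤ ((A ∩ C ∩ P) ∪ N).card := card_le_card hψK
      _ ≤ (A ∩ C ∩ P).card + N.card := card_union_le _ _
  -- inclusion–exclusion for J₁, J₂ and the partition of A ∩ C ∩ NE into M and N
  have hie : (J₁ ∪ J₂).card + K.card = J₁.card + J₂.card := card_union_add_card_inter J₁ J₂
  have hJUc : (J₁ ∪ J₂).card ≤ M.card := card_le_card hJU
  have hMN : M.card + N.card = (A ∩ C ∩ NE).card := card_inter_add_card_sdiff _ _
  have hL : ((A \ C) ∩ D1).card + ((C \ A) ∩ B2).card = I₁.card + I₂.card := by rw [hc₁, hc₂]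
  omega

end Summit.CriticalPhenomena.PercolationContinuityZ3.Theorems.Coefficientwise.SupplyMatching
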